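import Summits.CriticalPhenomena.PercolationContinuityZ3.Theorems.PercNearOneGluingNoHeavyLowerTailSahiOneStepFibreParam
import Summits.CriticalPhenomena.PercolationContinuityZ3.Theorems.PercNearOneGluingNoHeavyLowerTailSahiOneStepFreeExtension
import Summits.CriticalPhenomena.PercolationContinuityZ3.Theorems.PercNearOneGluingNoHeavyLowerTailSahiOneStepFibreStarVarLeFour
import Summits.CriticalPhenomena.PercolationContinuityZ3.Theorems.PercNearOneGluingNoHeavyLowerTailSahiOneStepFibreStarVarFiveA
import Summits.CriticalPhenomena.PercolationContinuityZ3.Theorems.PercNearOneGluingNoHeavyLowerTailSahiOneStepFibreStarVarFiveB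
import Mathlib.Algebra.BigOperators.Group.Finset.Powerset
import HarnessLib

/-!
# One-step scheme: Q-HARRIS `(3′)` for EVERY THRESHOLD FIRST SLOT ON AT MOST FIVE COORDINATES (kernel assembly of the fibre route)

Support file (prover prim-ineq-prove-3 gen 16; `--supports stmt-CriticalPhenomena-4575`; memo
`run/shared/lean/prim/prim-ineq-prove-3/FINDING-G16-FIBRE-MAJ5.md` §2, §3.6).  No definitions, no named facts, no sorries, no `native_decide`.

For `H = Th_t(F) = {ω | t ≤ #(F.filter (· ∈ ω))}` and `I ⊆ J ⊆ F`, `D = J ∖ I`, the two-copy fibre sum of `…SahiOneStepFibreParam` is evaluated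
(`phi2_threshold_eq`): with `u(R) = 1[↑(I ∪ R) ∈ A]`, `v(R) = 1[↑(I ∪ R) ∈ B]`, `h(R) = [t − |I| ≤ |R|]` it is the antipodal sum
`Σ_{R ⊆ D} h(R)u(R)v(R)(1 + h(D∖R)) − h(R)u(D∖R)v(D∖R) − h(R)h(D∖R)u(R)v(D∖R)`; `u, v` are nonnegative and monotone for increasing `A, B`;
for `|D| ≤ 5` the sum is `≥ 0` by the variable-form certificates `starVar_d{d}_s{s}` (`star_sum_nonneg_of_card_le_five`, a case analysis on
`|D|` and `s`).  Hence (`osMp_threshold_nonneg_of_card_le_five`) **`(1 + μH)·μ(H∩A∩B) ≥ μ(H)·μ(A∩B) + μ(H∩A)·μ(H∩B)` for every threshold slot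
`H = Th_t(F)` with `|F| ≤ 5`, every `t`, every product measure and ALL increasing `A, B ⊆ 2^ι`** (F-determined pairs first, then all pairs by the
free-coordinate extension `osMp_nonneg_all_of_determined`) — in particular for `maj₅`.  This is the `(3′)` half of the one-step hypotheses for these
slots; the `(2′)` half is verified by computation in the memo (§3) but not yet in the kernel.
-/

noncomputable section

namespace Summit.CriticalPhenomena.PercolationContinuityZ3.Theorems

namespace SahiOneStep

open MeasureTheory Finset
open Literature.Probability.Percolation (DeterminedBy determinedBy_iff determinedBy_univ)
open Literature.Probability.LatticeModels (prodBernoulli)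
open Literature.Probability.Percolation.DecisionTree (ind ind_of_mem ind_of_not_mem ind_nonneg)
open SahiE3Sections (determinedBy_section_insert determinedBy_section_sdiff)
open scoped Classical

variable {ι : Type*} [Fintype ι] [DecidableEq ι]

/-! ## The threshold slot and its patterns -/

omit [Fintype ι] [DecidableEq ι] in
/-- The threshold event `Th_t(F)` is determined by `F`. [folklore] -/
theorem determinedBy_threshold (F : Finset ι) (t : ℕ) :
    DeterminedBy {ω : Set ι | t ≤ (F.filter (· ∈ ω)).card} (↑F : Set ι) := by
  rw [determinedBy_iff]
  intro ω ω' h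
  have hf : F.filter (· ∈ ω) = F.filter (· ∈ ω') := by
    ext i
    simp only [Finset.mem_filter, and_congr_right_iff]
    intro hi
    have := Set.ext_iff.1 h i
    simp only [Set.mem_inter_iff, Finset.mem_coe] at this
    constructor
    · intro hω; exact (this.1 ⟨hω, hi⟩).1
    · intro hω'; exact (this.2 ⟨hω', hi⟩).1
  simp only [Set.mem_setOf_eq, hf]

omit [Fintype ι] in
/-- A pattern `S ⊆ F` lies in `Th_t(F)` iff `t ≤ |S|`. [folklore] -/
theorem coe_mem_threshold_iff (F : Finset ι) (t : ℕ) {S : Finset ι} (hS : S ⊆ F) :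
    (↑S : Set ι) ∈ {ω : Set ι | t ≤ (F.filter (· ∈ ω)).card} ↔ t ≤ S.card := by
  simp only [Set.mem_setOf_eq, Finset.mem_coe, Finset.filter_mem_eq_inter, Finset.inter_eq_right.2 hS]

omit [Fintype ι] [DecidableEq ι] in
/-- `ind (pat (X ∩ Y)) S = ind (pat X) S * ind (pat Y) S`. [folklore] -/
theorem ind_pat_inter (X Y : Set (Set ι)) (S : Finset ι) : ind (pat (X ∩ Y)) S = ind (pat X) S * ind (pat Y) S := by
  by_cases hX : (↑S : Set ι) ∈ X <;> by_cases hY : (↑S : Set ι) ∈ Y <;>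
    simp [ind_of_mem, ind_of_not_mem, mem_pat, hX, hY, Set.mem_inter_iff]

omit [Fintype ι] in
/-- Monotonicity of the pattern indicator of an increasing event along `X ↦ I ∪ X`. [folklore] -/
theorem ind_pat_union_mono {A : Set (Set ι)} (hA : IsUpperSet A) (I : Finset ι) {S T : Finset ι} (hST : S ⊆ T) :
    ind (pat A) (I ∪ S) ≤ ind (pat A) (I ∪ T) := by
  by_cases hS : (↑(I ∪ S) : Set ι) ∈ A
  · have hT : (↑(I ∪ T) : Set ι) ∈ A :=
      hA (by rw [Finset.coe_subset]; exact Finset.union_subset_union (le_refl I) hST) hS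
    rw [ind_of_mem (show I ∪ S ∈ pat A from hS), ind_of_mem (show I ∪ T ∈ pat A from hT)]
  · rw [ind_of_not_mem (show I ∪ S ∉ pat A from hS)]
    exact ind_nonneg _ _

/-! ## Evaluation of the two-copy summand on a threshold slot -/

omit [Fintype ι] in
/-- For `I ⊆ J`, `R ⊆ J ∖ I`: `J ∖ R = I ∪ ((J ∖ I) ∖ R)`. [folklore] -/
theorem sdiff_eq_union_sdiff_sdiff {I J R : Finset ι} (hIJ : I ⊆ J) (hR : R ⊆ J \ I) : J \ R = I ∪ ((J \ I) \ R) := by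
  ext i
  simp only [Finset.mem_sdiff, Finset.mem_union]
  constructor
  · rintro ⟨hj, hr⟩
    by_cases hi : i ∈ I
    · exact Or.inl hi
    · exact Or.inr ⟨⟨hj, hi⟩, hr⟩
  · rintro (hi | ⟨⟨hj, hi⟩, hr⟩)
    · refine ⟨hIJ hi, fun hr => ?_⟩
      exact (Finset.mem_sdiff.1 (hR hr)).2 hi
    · exact ⟨hj, hr⟩

omit [Fintype ι] in
/-- The threshold indicator on the pattern `I ∪ X`, `X ⊆ J ∖ I ⊆ F ∖ I`: `[t ≤ |I ∪ X|] = [t − |I| ≤ |X|]`. [folklore] -/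
theorem ind_pat_threshold_union (F : Finset ι) (t : ℕ) {I J X : Finset ι} (hIJ : I ⊆ J) (hJF : J ⊆ F) (hX : X ⊆ J \ I) :
    ind (pat {ω : Set ι | t ≤ (F.filter (· ∈ ω)).card}) (I ∪ X) = if t - I.card ≤ X.card then (1 : ℝ) else 0 := by
  have hsub : I ∪ X ⊆ F := Finset.union_subset (hIJ.trans hJF) ((hX.trans Finset.sdiff_subset).trans hJF)
  have hdisj : Disjoint I X := Finset.disjoint_left.2 fun i hi hx => (Finset.mem_sdiff.1 (hX hx)).2 hi
  have hcard : (I ∪ X).card = I.card + X.card := Finset.card_union_of_disjoint hdisj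
  have key : (I ∪ X ∈ pat {ω : Set ι | t ≤ (F.filter (· ∈ ω)).card}) ↔ t - I.card ≤ X.card := by
    rw [mem_pat, coe_mem_threshold_iff F t hsub, hcard]; omega
  by_cases h : t - I.card ≤ X.card
  · rw [if_pos h, ind_of_mem (key.2 h)]
  · rw [if_neg h, ind_of_not_mem (fun hm => h (key.1 hm))]

omit [Fintype ι] in
/-- **The two-copy summand of a threshold slot**, evaluated on the fibre `(I, J)` at `R ⊆ J ∖ I`. [this work] -/
theorem phi2_threshold_eq (F : Finset ι) (t : ℕ) (A B : Set (Set ι)) {I J R : Finset ι} (hIJ : I ⊆ J) (hJF : J ⊆ F)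
    (hR : R ⊆ J \ I) :
    phi2 {ω : Set ι | t ≤ (F.filter (· ∈ ω)).card} A B (I ∪ R) (J \ R) =
      (if t - I.card ≤ R.card then (1 : ℝ) else 0) * ind (pat A) (I ∪ R) * ind (pat B) (I ∪ R) *
          (1 + (if t - I.card ≤ ((J \ I) \ R).card then (1 : ℝ) else 0))
        - (if t - I.card ≤ R.card then (1 : ℝ) else 0) * ind (pat A) (I ∪ ((J \ I) \ R)) * ind (pat B) (I ∪ ((J \ I) \ R))
        - (if t - I.card ≤ R.card then (1 : ℝ) else 0) * (if t - I.card ≤ ((J \ I) \ R).card then (1 : ℝ) else 0) *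
            ind (pat A) (I ∪ R) * ind (pat B) (I ∪ ((J \ I) \ R)) := by
  have hRc : (J \ I) \ R ⊆ J \ I := Finset.sdiff_subset
  rw [sdiff_eq_union_sdiff_sdiff hIJ hR]
  unfold phi2
  simp only [ind_pat_inter]
  rw [ind_pat_threshold_union F t hIJ hJF hR, ind_pat_threshold_union F t hIJ hJF hRc]
  ring

/-! ## The antipodal sums are nonnegative for at most five free coordinates -/

omit [Fintype ι] in
/-- If the threshold exceeds the number of free coordinates, the antipodal sum vanishes termwise. [folklore] -/
theorem star_sum_eq_zero_of_lt (D : Finset ι) {s : ℕ} (hs : D.card < s) (u v : Finset ι → ℝ) :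
    ∑ R ∈ D.powerset, ((if s ≤ R.card then (1 : ℝ) else 0) * u R * v R * (1 + (if s ≤ (D \ R).card then (1 : ℝ) else 0))
        - (if s ≤ R.card then (1 : ℝ) else 0) * u (D \ R) * v (D \ R)
        - (if s ≤ R.card then (1 : ℝ) else 0) * (if s ≤ (D \ R).card then (1 : ℝ) else 0) * u R * v (D \ R)) = 0 := by
  refine Finset.sum_eq_zero fun R hR => ?_
  have h1 : ¬ s ≤ R.card := fun h => by
    have := Finset.card_le_card (Finset.mem_powerset.1 hR); omega
  simp only [if_neg h1, zero_mul, sub_self]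

omit [Fintype ι] in
/-- **Antipodal sums with a threshold trace are nonnegative for `|D| ≤ 5`** (case analysis on `|D|` and `s` into the certificates
`starVar_d{d}_s{s}`). [this work] -/
theorem star_sum_nonneg_of_card_le_five (D : Finset ι) (hD : D.card ≤ 5) (s : ℕ) (u v : Finset ι → ℝ)
    (hu : ∀ S T : Finset ι, S ⊆ T → u S ≤ u T) (hu0 : ∀ S, 0 ≤ u S)
    (hv : ∀ S T : Finset ι, S ⊆ T → v S ≤ v T) (hv0 : ∀ S, 0 ≤ v S) :
    0 ≤ ∑ R ∈ D.powerset, ((if s ≤ R.card then (1 : ℝ) else 0) * u R * v R * (1 + (if s ≤ (D \ R).card then (1 : ℝ) else 0))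
        - (if s ≤ R.card then (1 : ℝ) else 0) * u (D \ R) * v (D \ R)
        - (if s ≤ R.card then (1 : ℝ) else 0) * (if s ≤ (D \ R).card then (1 : ℝ) else 0) * u R * v (D \ R)) := by
  by_cases hs : D.card < s
  · rw [star_sum_eq_zero_of_lt D hs u v]
  rw [not_lt] at hs
  -- enumerate the elements of `D`
  rcases Nat.lt_or_ge D.card 1 with h0 | h1
  · -- |D| = 0
    have hD0 : D = ∅ := Finset.card_eq_zero.1 (by omega)
    have hs0 : s = 0 := by omega
    subst hD0; subst hs0
    simp only [Finset.powerset_empty, Finset.sum_singleton, Finset.card_empty, le_refl, if_true, Finset.sdiff_self]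
    linarith
  -- |D| ≥ 1: peel elements one at a time
  obtain ⟨x0, D1, hx0, rfl, hc1⟩ := Finset.card_eq_succ.1 (show D.card = (D.card - 1) + 1 by omega)
  rcases Nat.eq_zero_or_pos D1.card with hz1 | hp1
  · have hD1 : D1 = ∅ := Finset.card_eq_zero.1 hz1
    subst hD1
    have hs1 : s ≤ 1 := by rw [Finset.card_insert_of_notMem hx0, Finset.card_empty] at hs; omega
    rw [Finset.insert_empty]
    interval_cases s
    · exact starVar_d1_s0 x0 u v hu hv
    · exact starVar_d1_s1 x0 u v hu hu0 hv hv0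
  obtain ⟨x1, D2, hx1, rfl, hc2⟩ := Finset.card_eq_succ.1 (show D1.card = (D1.card - 1) + 1 by omega)
  have h01 : x0 ≠ x1 := by rintro rfl; simp at hx0
  rcases Nat.eq_zero_or_pos D2.card with hz2 | hp2
  · have hD2 : D2 = ∅ := Finset.card_eq_zero.1 hz2
    subst hD2
    have hs2 : s ≤ 2 := by
      rw [Finset.card_insert_of_notMem hx0, Finset.card_insert_of_notMem hx1, Finset.card_empty] at hs; omega
    rw [Finset.insert_empty]
    interval_cases s
    · exact starVar_d2_s0 x0 x1 h01 u v hu hv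
    · exact starVar_d2_s1 x0 x1 h01 u v hu hu0 hv hv0
    · exact starVar_d2_s2 x0 x1 h01 u v hu hu0 hv hv0
  obtain ⟨x2, D3, hx2, rfl, hc3⟩ := Finset.card_eq_succ.1 (show D2.card = (D2.card - 1) + 1 by omega)
  have h02 : x0 ≠ x2 := by rintro rfl; simp at hx0
  have h12 : x1 ≠ x2 := by rintro rfl; simp at hx1
  rcases Nat.eq_zero_or_pos D3.card with hz3 | hp3
  · have hD3 : D3 = ∅ := Finset.card_eq_zero.1 hz3
    subst hD3
    have hs3 : s ≤ 3 := by
      rw [Finset.card_insert_of_notMem hx0, Finset.card_insert_of_notMem hx1, Finset.card_insert_of_notMem hx2, Finset.card_empty] at hs; omega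
    rw [Finset.insert_empty]
    interval_cases s
    · exact starVar_d3_s0 x0 x1 x2 h01 h02 h12 u v hu hv
    · exact starVar_d3_s1 x0 x1 x2 h01 h02 h12 u v hu hu0 hv hv0
    · exact starVar_d3_s2 x0 x1 x2 h01 h02 h12 u v hu hu0 hv hv0
    · exact starVar_d3_s3 x0 x1 x2 h01 h02 h12 u v hu hu0 hv hv0
  obtain ⟨x3, D4, hx3, rfl, hc4⟩ := Finset.card_eq_succ.1 (show D3.card = (D3.card - 1) + 1 by omega)
  have h03 : x0 ≠ x3 := by rintro rfl; simp at hx0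
  have h13 : x1 ≠ x3 := by rintro rfl; simp at hx1
  have h23 : x2 ≠ x3 := by rintro rfl; simp at hx2
  rcases Nat.eq_zero_or_pos D4.card with hz4 | hp4
  · have hD4 : D4 = ∅ := Finset.card_eq_zero.1 hz4
    subst hD4
    have hs4 : s ≤ 4 := by
      rw [Finset.card_insert_of_notMem hx0, Finset.card_insert_of_notMem hx1, Finset.card_insert_of_notMem hx2,
        Finset.card_insert_of_notMem hx3, Finset.card_empty] at hs; omega
    rw [Finset.insert_empty]
    interval_cases s
    · exact starVar_d4_s0 x0 x1 x2 x3 h01 h02 h03 h12 h13 h23 u v hu hv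
    · exact starVar_d4_s1 x0 x1 x2 x3 h01 h02 h03 h12 h13 h23 u v hu hu0 hv hv0
    · exact starVar_d4_s2 x0 x1 x2 x3 h01 h02 h03 h12 h13 h23 u v hu hu0 hv hv0
    · exact starVar_d4_s3 x0 x1 x2 x3 h01 h02 h03 h12 h13 h23 u v hu hu0 hv hv0
    · exact starVar_d4_s4 x0 x1 x2 x3 h01 h02 h03 h12 h13 h23 u v hu hu0 hv hv0
  obtain ⟨x4, D5, hx4, rfl, hc5⟩ := Finset.card_eq_succ.1 (show D4.card = (D4.card - 1) + 1 by omega)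
  have h04 : x0 ≠ x4 := by rintro rfl; simp at hx0
  have h14 : x1 ≠ x4 := by rintro rfl; simp at hx1
  have h24 : x2 ≠ x4 := by rintro rfl; simp at hx2
  have h34 : x3 ≠ x4 := by rintro rfl; simp at hx3
  have hD5 : D5 = ∅ := Finset.card_eq_zero.1 (by
    rw [Finset.card_insert_of_notMem hx0, Finset.card_insert_of_notMem hx1, Finset.card_insert_of_notMem hx2,
      Finset.card_insert_of_notMem hx3, Finset.card_insert_of_notMem hx4] at hD; omega)
  subst hD5
  have hs5 : s ≤ 5 := by
    rw [Finset.card_insert_of_notMem hx0, Finset.card_insert_of_notMem hx1, Finset.card_insert_of_notMem hx2,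
      Finset.card_insert_of_notMem hx3, Finset.card_insert_of_notMem hx4, Finset.card_empty] at hs; omega
  rw [Finset.insert_empty]
  interval_cases s
  · exact starVar_d5_s0 x0 x1 x2 x3 x4 h01 h02 h03 h04 h12 h13 h14 h23 h24 h34 u v hu hv
  · exact starVar_d5_s1 x0 x1 x2 x3 x4 h01 h02 h03 h04 h12 h13 h14 h23 h24 h34 u v hu hu0 hv hv0
  · exact starVar_d5_s2 x0 x1 x2 x3 x4 h01 h02 h03 h04 h12 h13 h14 h23 h24 h34 u v hu hu0 hv hv0
  · exact starVar_d5_s3 x0 x1 x2 x3 x4 h01 h02 h03 h04 h12 h13 h14 h23 h24 h34 u v hu hu0 hv hv0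
  · exact starVar_d5_s4 x0 x1 x2 x3 x4 h01 h02 h03 h04 h12 h13 h14 h23 h24 h34 u v hu hu0 hv hv0
  · exact starVar_d5_s5 x0 x1 x2 x3 x4 h01 h02 h03 h04 h12 h13 h14 h23 h24 h34 u v hu hu0 hv hv0

/-! ## Assembly: Q-HARRIS for threshold slots on at most five coordinates -/

/-- **`(3′)` for every threshold slot on `≤ 5` coordinates, F-determined pairs.** [this work] -/
theorem osMp_threshold_nonneg_of_card_le_five (p : ι → unitInterval) (F : Finset ι) (hF : F.card ≤ 5) (t : ℕ) {A B : Set (Set ι)}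
    (hA : IsUpperSet A) (hB : IsUpperSet B) (hAF : DeterminedBy A (↑F : Set ι)) (hBF : DeterminedBy B (↑F : Set ι)) :
    0 ≤ osMp p {ω : Set ι | t ≤ (F.filter (· ∈ ω)).card} (ind A) (ind B) := by
  refine osMp_ind_ind_nonneg_of_fibre2' p (determinedBy_threshold F t) hAF hBF fun I J hIJ hJF => ?_
  rw [Finset.sum_congr rfl fun R hR => phi2_threshold_eq F t A B hIJ hJF (Finset.mem_powerset.1 hR)]
  have hD : (J \ I).card ≤ 5 := (Finset.card_le_card (Finset.sdiff_subset.trans hJF)).trans hF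
  exact star_sum_nonneg_of_card_le_five (J \ I) hD (t - I.card) (fun X => ind (pat A) (I ∪ X)) (fun X => ind (pat B) (I ∪ X))
    (fun S T h => ind_pat_union_mono hA I h) (fun S => ind_nonneg _ _) (fun S T h => ind_pat_union_mono hB I h) (fun S => ind_nonneg _ _)

/-- **Free-coordinate extension for `m′` alone**: if `H` is determined by `F` and `m′ ≥ 0` on all pairs of increasing `F`-determined events, then
`m′ ≥ 0` on ALL pairs of increasing events (the `m′` half of `…FreeExtension.osMp_osN_nonneg_of_determined`). [this work] -/
theorem osMp_nonneg_all_of_determined (p : ι → unitInterval) {H : Set (Set ι)} {F : Finset ι} (hH : DeterminedBy H (F : Set ι))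
    (h3 : ∀ A B : Set (Set ι), IsUpperSet A → IsUpperSet B → DeterminedBy A (F : Set ι) → DeterminedBy B (F : Set ι) →
      0 ≤ osMp p H (ind A) (ind B))
    {A B : Set (Set ι)} (hA : IsUpperSet A) (hB : IsUpperSet B) : 0 ≤ osMp p H (ind A) (ind B) := by
  suffices key : ∀ G : Finset ι, ∀ A B : Set (Set ι), IsUpperSet A → IsUpperSet B →
      DeterminedBy A (((F ∪ G : Finset ι)) : Set ι) → DeterminedBy B (((F ∪ G : Finset ι)) : Set ι) → 0 ≤ osMp p H (ind A) (ind B) by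
    have hsub : (Set.univ : Set ι) ⊆ (((F ∪ Finset.univ : Finset ι)) : Set ι) := fun i _ => by
      simp only [Finset.coe_union, Finset.coe_univ, Set.mem_union, Set.mem_univ, or_true]
    exact key Finset.univ A B hA hB ((SahiE3Sections.determinedBy_univ_set A).mono hsub) ((SahiE3Sections.determinedBy_univ_set B).mono hsub)
  intro G
  induction G using Finset.induction_on with
  | empty =>
    intro A B hA hB hAF hBF
    rw [Finset.union_empty] at hAF hBF
    exact h3 A B hA hB hAF hBF
  | insert e G heG ih =>
    intro A B hA hB hAF hBF
    by_cases he : e ∈ F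
    · have hFG : F ∪ insert e G = F ∪ G := by
        ext i; simp only [Finset.mem_union, Finset.mem_insert]
        constructor
        · rintro (h | rfl | h)
          · exact Or.inl h
          · exact Or.inl he
          · exact Or.inr h
        · rintro (h | h)
          · exact Or.inl h
          · exact Or.inr (Or.inr h)
      rw [hFG] at hAF hBF
      exact ih A B hA hB hAF hBF
    · have hHe : DeterminedBy H ((({e} : Finset ι) : Set ι)ᶜ) :=
        hH.mono fun i hi hie => he (by rw [Finset.coe_singleton, Set.mem_singleton_iff] at hie; rw [← hie]; exact hi)
      have hsub : (((F ∪ insert e G : Finset ι)) : Set ι) \ {e} ⊆ (((F ∪ G : Finset ι)) : Set ι) := by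
        intro i hi
        simp only [Set.mem_sdiff, Finset.mem_coe, Finset.mem_union, Finset.mem_insert, Set.mem_singleton_iff] at hi
        simp only [Finset.coe_union, Set.mem_union, Finset.mem_coe]
        rcases hi with ⟨h | rfl | h, hne⟩
        · exact Or.inl h
        · exact absurd rfl hne
        · exact Or.inr h
      have hA1 : DeterminedBy {ω : Set ι | insert e ω ∈ A} (((F ∪ G : Finset ι)) : Set ι) := (determinedBy_section_insert hAF e).mono hsub
      have hA0 : DeterminedBy {ω : Set ι | ω \ {e} ∈ A} (((F ∪ G : Finset ι)) : Set ι) := (determinedBy_section_sdiff hAF e).mono hsub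
      have hB1 : DeterminedBy {ω : Set ι | insert e ω ∈ B} (((F ∪ G : Finset ι)) : Set ι) := (determinedBy_section_insert hBF e).mono hsub
      have hB0 : DeterminedBy {ω : Set ι | ω \ {e} ∈ B} (((F ∪ G : Finset ι)) : Set ι) := (determinedBy_section_sdiff hBF e).mono hsub
      have m11 := ih _ _ (isUpperSet_section_insert hA e) (isUpperSet_section_insert hB e) hA1 hB1
      have m00 := ih _ _ (isUpperSet_section_sdiff hA e) (isUpperSet_section_sdiff hB e) hA0 hB0
      have hp0 : 0 ≤ (p e : ℝ) := (p e).2.1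
      have hq0 : 0 ≤ 1 - (p e : ℝ) := sub_nonneg.2 (p e).2.2
      rw [osMp_ind_ind_free_split p e hHe A B]
      have dA : 0 ≤ (prodBernoulli p).real (H ∩ {ω : Set ι | insert e ω ∈ A}) -
          (prodBernoulli p).real (H ∩ {ω : Set ι | ω \ {e} ∈ A}) :=
        sub_nonneg.2 (measureReal_mono (Set.inter_subset_inter_right _ (section_sdiff_subset_section_insert hA e)))
      have dB : 0 ≤ (prodBernoulli p).real (H ∩ {ω : Set ι | insert e ω ∈ B}) -
          (prodBernoulli p).real (H ∩ {ω : Set ι | ω \ {e} ∈ B}) :=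
        sub_nonneg.2 (measureReal_mono (Set.inter_subset_inter_right _ (section_sdiff_subset_section_insert hB e)))
      have t1 := mul_nonneg hp0 m11
      have t2 := mul_nonneg hq0 m00
      have t3 := mul_nonneg (mul_nonneg hp0 hq0) (mul_nonneg dA dB)
      linarith

/-- **Q-HARRIS FOR EVERY THRESHOLD FIRST SLOT ON AT MOST FIVE COORDINATES.**  For every finite `ι`, every product measure, every `F` with `|F| ≤ 5`,
every `t`, `H = {ω | t ≤ #(F ∩ ω)}` and ALL increasing `A, B ⊆ 2^ι`:
`m′(H;A,B) = (1 + μH)·μ(H∩A∩B) − μ(H)·μ(A∩B) − μ(H∩A)·μ(H∩B) ≥ 0` — in particular for `H = maj₅`. [this work] -/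
theorem osMp_threshold_nonneg_all_of_card_le_five (p : ι → unitInterval) (F : Finset ι) (hF : F.card ≤ 5) (t : ℕ) {A B : Set (Set ι)}
    (hA : IsUpperSet A) (hB : IsUpperSet B) :
    0 ≤ osMp p {ω : Set ι | t ≤ (F.filter (· ∈ ω)).card} (ind A) (ind B) :=
  osMp_nonneg_all_of_determined p (determinedBy_threshold F t)
    (fun _ _ hA hB hAF hBF => osMp_threshold_nonneg_of_card_le_five p F hF t hA hB hAF hBF) hA hB

/-- The same in measure form: `μ(H∩A)·μ(H∩B) + μ(H)·μ(A∩B) ≤ (1 + μH)·μ(H∩A∩B)`. [this work] -/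
theorem qharris_threshold_of_card_le_five (p : ι → unitInterval) (F : Finset ι) (hF : F.card ≤ 5) (t : ℕ) {A B : Set (Set ι)}
    (hA : IsUpperSet A) (hB : IsUpperSet B) :
    (prodBernoulli p).real ({ω : Set ι | t ≤ (F.filter (· ∈ ω)).card} ∩ A) *
        (prodBernoulli p).real ({ω : Set ι | t ≤ (F.filter (· ∈ ω)).card} ∩ B)
      + (prodBernoulli p).real {ω : Set ι | t ≤ (F.filter (· ∈ ω)).card} * (prodBernoulli p).real (A ∩ B) ≤
      (1 + (prodBernoulli p).real {ω : Set ι | t ≤ (F.filter (· ∈ ω)).card}) *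
        (prodBernoulli p).real ({ω : Set ι | t ≤ (F.filter (· ∈ ω)).card} ∩ A ∩ B) := by
  have h := osMp_threshold_nonneg_all_of_card_le_five p F hF t hA hB
  rw [osMp_ind_ind] at h
  linarith

end SahiOneStep

end Summit.CriticalPhenomena.PercolationContinuityZ3.Theorems
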